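import Summits.Ventures.Crystal3D.Theorems.StickyWulffConstantCoaxialWallLawSeamStarClosure
import Summits.Ventures.Crystal3D.Theorems.StickyWulffConstantCoaxialWallLawSaturatedStar
import HarnessLib

/-!
# The E1 STAR ROW of the cap table: a core ball carrying a closed vertex star of a star-closed core has at most `11 − deg_core` junk contacts (under `P5Exhaustion`)
# (crux `CoaxialWallLaw`, stmt-Ventures-19481; line `WallLedgerF`, skeleton 'CoaxialWallLawCertificates', repair of the v8.2 input `stub_unionCoreCap`)

HONEST FRAMING. Venture `Summits/Ventures/Crystal3D` (cell `crystal3d-full`); the cap-table row that the refuted input `UnionCoreCap` ('…SeamUnionCoreCapRefuted',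
`not_unionCoreCap`) was missing.  E1 (`P5Exhaustion`, the registered computational stub `stub_E1` of lanes G/F/T) says a twelve-fold ball whose shell contains a
closed slot star has the slot dozen or a twin dozen as shell ('…SaturatedStar', 19481-p1 p732252); for a STAR-CLOSED core ('…SeamStarClosure') all those twelve
balls are core balls (slot positions by the star-site rule, mirrored positions because they cap a hexagon-pair triangle, `reflect_slot_mem_of_capClosed`), so such
a ball has NO junk contact; otherwise it has at most eleven contacts.  Hence the row «closed star in the core ⇒ junk ≤ 11 − deg_core»: a lone exact cluster keeps
one unit of certified deficiency at every dozen ball (capped pool `5` at its loaded balls instead of `0`).  `P5Exhaustion` is a HYPOTHESIS here (named, registered,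
certified by cf-p2 R38; not a kernel theorem).  Nothing about the stubs is claimed; F-C1 not moved.
* `starCap D y` — the row (`11 − #core contacts` if some frame exhibits a closed slot star of `D` at `y`, else `12`); `capTable₃ := capTable₂ ⊓ starCap`;
* `JunkCapBoundStar cap` — the junk cap bound over STAR-CLOSED cores; `junkCapBoundStar_of_closed` (every `JunkCapBoundClosed` row qualifies), `junkCapBoundStar_min`;
* **`junkCapBoundStar_starCap (hE1 : P5Exhaustion)`**, **`junkCapBoundStar_capTable₃ (hE1)`**; reading lemmas `capTable₃_le_capTable₂`, `capTable₃_le_of_star`.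
-/

noncomputable section

namespace Summit.Ventures.Crystal3D.Theorems

namespace TailResidue

open Summit.Ventures.Crystal3D Finset
open scoped InnerProductSpace

/-! ### The row and the bound over star-closed cores -/

open scoped Classical in
/-- **THE STAR ROW**: at a core ball `y` carrying a CLOSED VERTEX STAR `{y + A u : 0 < ⟪u, δ⟫}` of the core (some frame `A`, some slot `δ`), the value
`11 − #core contacts of y`; the kissing number `12` otherwise. -/
def starCap (D : Finset (EuclideanSpace ℝ (Fin 3))) (y : EuclideanSpace ℝ (Fin 3)) : ℕ :=
  if ∃ A : EuclideanSpace ℝ (Fin 3) ≃ₗᵢ[ℝ] EuclideanSpace ℝ (Fin 3), ∃ δ ∈ fccSlots, ∀ u ∈ fccSlots, 0 < ⟪u, δ⟫_ℝ → y + A u ∈ D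
  then 11 - (D.filter fun q => dist y q = 1).card else 12

/-- **THE CAP TABLE WITH THE STAR ROW**: `capTable₂ ⊓ starCap`. -/
def capTable₃ (D : Finset (EuclideanSpace ℝ (Fin 3))) (y : EuclideanSpace ℝ (Fin 3)) : ℕ := min (capTable₂ D y) (starCap D y)

/-- The new table lowers the table of record. -/
theorem capTable₃_le_capTable₂ (D : Finset (EuclideanSpace ℝ (Fin 3))) (y : EuclideanSpace ℝ (Fin 3)) : capTable₃ D y ≤ capTable₂ D y := min_le_left _ _

open scoped Classical in
/-- Reading the star row: an exhibited closed slot star of the core at `y` gives `capTable₃ D y ≤ 11 − #core contacts`. -/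
theorem capTable₃_le_of_star {D : Finset (EuclideanSpace ℝ (Fin 3))} {y : EuclideanSpace ℝ (Fin 3)} (A : EuclideanSpace ℝ (Fin 3) ≃ₗᵢ[ℝ] EuclideanSpace ℝ (Fin 3))
    {δ : EuclideanSpace ℝ (Fin 3)} (hδ : δ ∈ fccSlots) (hstar : ∀ u ∈ fccSlots, 0 < ⟪u, δ⟫_ℝ → y + A u ∈ D) :
    capTable₃ D y ≤ 11 - (D.filter fun q => dist y q = 1).card := by
  refine (min_le_right _ _).trans ?_
  unfold starCap
  rw [if_pos ⟨A, δ, hδ, hstar⟩]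

open scoped Classical in
/-- **JUNK CAP BOUND FOR STAR-CLOSED CORES**: for every `1`-separated `X`, payer point `z`, STAR-CLOSED core `D` in the window, and core ball `y` within `2` of `z`,
the junk contacts of `y` number at most `cap D y`. -/
def JunkCapBoundStar (cap : Finset (EuclideanSpace ℝ (Fin 3)) → EuclideanSpace ℝ (Fin 3) → ℕ) : Prop :=
  ∀ X : Finset (EuclideanSpace ℝ (Fin 3)), (∀ p ∈ X, ∀ q ∈ X, p ≠ q → 1 ≤ dist p q) →
  ∀ z : EuclideanSpace ℝ (Fin 3), ∀ D : Finset (EuclideanSpace ℝ (Fin 3)), IsStarClosed X z D →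
  ∀ y ∈ D, dist z y ≤ 2 → ((X \ D).filter fun x => dist y x = 1).card ≤ cap D y

/-- Every row valid for cap-closed cores is valid for star-closed cores. -/
theorem junkCapBoundStar_of_closed {cap : Finset (EuclideanSpace ℝ (Fin 3)) → EuclideanSpace ℝ (Fin 3) → ℕ} (h : JunkCapBoundClosed cap) : JunkCapBoundStar cap :=
  fun X hX z D hD y hy hzy => h X hX z D hD.capClosed y hy hzy

/-- Rows combine by pointwise `min`. -/
theorem junkCapBoundStar_min {cap cap' : Finset (EuclideanSpace ℝ (Fin 3)) → EuclideanSpace ℝ (Fin 3) → ℕ} (h : JunkCapBoundStar cap) (h' : JunkCapBoundStar cap') :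
    JunkCapBoundStar fun D y => min (cap D y) (cap' D y) :=
  fun X hX z D hD y hy hzy => le_min (h X hX z D hD y hy hzy) (h' X hX z D hD y hy hzy)

/-- Monotonicity. -/
theorem junkCapBoundStar_mono {cap cap' : Finset (EuclideanSpace ℝ (Fin 3)) → EuclideanSpace ℝ (Fin 3) → ℕ} (h : JunkCapBoundStar cap) (hle : ∀ D y, cap D y ≤ cap' D y) :
    JunkCapBoundStar cap' :=
  fun X hX z D hD y hy hzy => (h X hX z D hD y hy hzy).trans (hle _ _)

/-! ### The star row is a junk cap bound (E1) -/

open scoped Classical in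
/-- Contacts split into core contacts and junk contacts. -/
theorem card_contacts_eq_junk_add_core {X D : Finset (EuclideanSpace ℝ (Fin 3))} (hDX : D ⊆ X) (y : EuclideanSpace ℝ (Fin 3)) :
    (X.filter fun q => dist y q = 1).card = ((X \ D).filter fun x => dist y x = 1).card + (D.filter fun q => dist y q = 1).card := by
  rw [← card_union_of_disjoint (disjoint_filter_filter sdiff_disjoint), ← filter_union, sdiff_union_of_subset hDX]

open scoped Classical in
/-- **In a star-closed core, a twelve-fold ball carrying a closed slot star of the core has NO junk contact** (E1: its shell is the slot dozen — star sites — or a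
twin dozen — own part star sites, mirrored part capping hexagon-pair triangles). -/
theorem junk_eq_zero_of_star_twelve (hE1 : P5Exhaustion) {X D : Finset (EuclideanSpace ℝ (Fin 3))} (hX : ∀ p ∈ X, ∀ q ∈ X, p ≠ q → 1 ≤ dist p q)
    {z : EuclideanSpace ℝ (Fin 3)} (hD : IsStarClosed X z D) {y : EuclideanSpace ℝ (Fin 3)} (hy : y ∈ D) (hzy : dist z y ≤ 2)
    (A : EuclideanSpace ℝ (Fin 3) ≃ₗᵢ[ℝ] EuclideanSpace ℝ (Fin 3)) {δ : EuclideanSpace ℝ (Fin 3)} (hδ : δ ∈ fccSlots) (hstar : ∀ u ∈ fccSlots, 0 < ⟪u, δ⟫_ℝ → y + A u ∈ D)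
    (h12 : (X.filter fun q => dist y q = 1).card = 12) : ((X \ D).filter fun x => dist y x = 1).card = 0 := by
  have hsite : ∀ w ∈ fccSlots, y + A w ∈ X → y + A w ∈ D := fun w hw hmem =>
    hD.mem_of_starSiteIn hmem (by linarith [dist_triangle z y (y + A w), dist_slotSite_eq_one A y hw]) ⟨y, hy, A, δ, hδ, hstar, w, hw, rfl⟩
  have hall : ∀ q ∈ X, dist y q = 1 → q ∈ D := by
    intro q hq hqd
    rcases shell_slots_or_twin_of_star_twelve hE1 A hX hδ (fun w hw hpos => hD.subset (hstar w hw hpos)) h12 with h | ⟨n, hn, hown, h⟩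
    · obtain ⟨w, hw, rfl⟩ := h q hq hqd
      exact hsite w hw hq
    · rcases h q hq hqd with ⟨w, hw, -, rfl⟩ | ⟨w, hw, -, rfl⟩
      · exact hsite w hw hq
      · exact reflect_slot_mem_of_capClosed hD.capClosed hy hzy hn (fun u hu h0 => hsite u hu (hown u hu h0.le)) hw hq
  rw [card_eq_zero, eq_empty_iff_forall_notMem]
  intro x hx
  obtain ⟨hx, hxd⟩ := mem_filter.1 hx
  exact (mem_sdiff.1 hx).2 (hall x (mem_sdiff.1 hx).1 hxd)

open scoped Classical in
/-- **THE STAR ROW IS A JUNK CAP BOUND over star-closed cores (under E1).** -/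
theorem junkCapBoundStar_starCap (hE1 : P5Exhaustion) : JunkCapBoundStar starCap := by
  intro X hX z D hD y hy hzy
  unfold starCap
  split_ifs with h
  · obtain ⟨A, δ, hδ, hstar⟩ := h
    have hsplit := card_contacts_eq_junk_add_core hD.subset y
    have h12 := card_filter_dist_eq_one_le_twelve X hX y
    by_contra hlt
    have heq : (X.filter fun q => dist y q = 1).card = 12 := by omega
    have h0 := junk_eq_zero_of_star_twelve hE1 hX hD hy hzy A hδ hstar heq
    omega
  · exact junk_contacts_le_twelve hX _ y

/-- **`JunkCapBoundStar capTable₃`** (under E1): the table of record plus the star row holds for every star-closed core. -/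
theorem junkCapBoundStar_capTable₃ (hE1 : P5Exhaustion) : JunkCapBoundStar capTable₃ :=
  junkCapBoundStar_min (junkCapBoundStar_of_closed junkCapBoundClosed_capTable₂) (junkCapBoundStar_starCap hE1)

end TailResidue

end Summit.Ventures.Crystal3D.Theorems

end
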